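import Summits.ValiantsHypothesis.ValiantsHypothesis.Theorems.TwistedDetRankSliceVBPFermionicDEven

/-!
# Crux `TwistedDetRank.SliceVBPFermionic` (stmt-ValiantsHypothesis-17991, X2b) — the LAYER-SWITCH
# GADGET: `D^even_{4a}` projects onto `Σ_ρ sgn ρ · #{2-colourings of ρ} · Y^ρ`

`D^even_n = Σ_{σ : all cycles even} sgn σ X^σ` was the one falsifier candidate against X2b that
the first prover's census could neither kill (no reduction from the permanent) nor bound
(Cruxes/SliceVBPFermionic/CALIBRATION.md §3).  This file builds the reduction's first and only
non-standard step, a PROJECTION (substitution of variables and constants):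

* §1 THE GADGET.  Index `4a` points as `Fin a × (Bool ⊕ Bool)`: point `i` has two LAYER vertices
  `(i, inl b)` and two middle vertices `m_i = (i, inr false)`, `m'_i = (i, inr true)`.  The
  substitution `laySubst` puts the variable `y_{j i}` on the edges `(i, inl b) → (j, inl b)` of
  BOTH layers and the constant `1` on `(i, inl b) → m_i → m'_i → (i, inl b')`; all other entries
  are `0`.
* §2 THE COVERS.  In a cycle cover of the substituted matrix, `m_i` is entered from one layer
  vertex of `i` and `m'_i` returns to one; returning to the SAME layer closes the `3`-cycle
  `(i, inl b) → m_i → m'_i → (i, inl b)` — an ODD cycle, killed by the coefficient of `D^even`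
  (`dEvenClass_eq_zero_of_pow_apply_eq_self`); returning to the OTHER layer is a layer switch, and
  then the strand leaves `i` on layer `¬b` towards `ρ(i)`, which it must enter on its entry layer.
  So the surviving covers are exactly the permutations `layPerm ρ s` for `ρ ∈ 𝔖_a` and a
  `2`-COLOURING `s : Fin a → Bool`, `s (ρ i) = ¬ s i` (`exists_layPerm_of_support`); each is
  all-even (it carries the `2`-colouring `layColour`), has sign `(-1)^a sgn ρ`
  (`sign_layPerm`) and monomial `Y^ρ` (`prod_laySubst_layPerm`).
* This file: the substitution (§1) and the covers `layPerm ρ s` with their sign, `2`-colouring,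
  monomial and injectivity (§2).  The sequel `…DEvenGadgetCovers` proves that nothing else survives
  and the identity `D^even_{4a}(laySubst) = Σ_ρ (-1)^a sgn ρ · #{s : s ∘ ρ = ¬ s} · Y^ρ`;
  `…DEvenHard` doubles it onto `± Ferm²`, per-hard in the tree.

HONEST FRAMING.  A gadget identity; the complexity consequences are drawn in the sequel.  X2b is
≥ `VNP ⊄ VBP` and is neither proved nor refuted here.  `VP ≠ VNP` is not moved by this item.

References: L. G. Valiant, STOC 1979 (projections); S. Mertens, C. Moore, Theory of Computing 9
(2013) 273–282, §3 (parity gadgets for fermionants); P. Bürgisser, *Completeness and Reduction in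
Algebraic Complexity Theory* (2000) §2.1.  The `def`s below (`laySubst`, `layCycle`, `layEntry`,
`layPerm`, `layColour`) are proof gadgets naming the substitution and its covers, not route
objects.
-/

-- single-conjunct layout: Sub = Summit, duplicated namespace component intended
set_option linter.dupNamespace false

noncomputable section

namespace Summit.ValiantsHypothesis.ValiantsHypothesis.Theorems.TwistedDetRankSliceVBPFermionic

open Equiv Equiv.Perm MvPolynomial
open scoped BigOperators

section LayerGadget

variable {a : ℕ}

/-! ## §1 The substitution -/

/-- THE LAYER-SWITCH SUBSTITUTION on `Fin a × (Bool ⊕ Bool)` (entry `(target, source)` = weight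
of the edge `source → target`): `y_{j i}` on `(i, inl b) → (j, inl b)` (both layers `b`), `1` on
`(i, inl b) → (i, inr false) → (i, inr true) → (i, inl b')`, `0` elsewhere.  A proof gadget, not
a route object. [folklore] -/
def laySubst :
    (Fin a × (Bool ⊕ Bool)) × (Fin a × (Bool ⊕ Bool)) → MvPolynomial (Fin a × Fin a) ℂ
  | ((j, Sum.inl b'), (i, Sum.inl b)) => if b = b' then X (j, i) else 0
  | ((j, Sum.inr false), (i, Sum.inl _)) => if i = j then 1 else 0
  | ((j, Sum.inr true), (i, Sum.inr false)) => if i = j then 1 else 0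
  | ((j, Sum.inl _), (i, Sum.inr true)) => if i = j then 1 else 0
  | ((_, Sum.inr true), (_, Sum.inl _)) => 0
  | ((_, Sum.inl _), (_, Sum.inr false)) => 0
  | ((_, Sum.inr false), (_, Sum.inr false)) => 0
  | ((_, Sum.inr _), (_, Sum.inr true)) => 0

/-- Layer edges carry the variables. -/
@[simp] theorem laySubst_inl_inl (j i : Fin a) (b' b : Bool) :
    laySubst ((j, Sum.inl b'), (i, Sum.inl b)) = if b = b' then X (j, i) else 0 := rfl
/-- Layer → middle: `1` on the diagonal. -/
@[simp] theorem laySubst_mid_inl (j i : Fin a) (b : Bool) :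
    laySubst ((j, Sum.inr false), (i, Sum.inl b)) = if i = j then 1 else 0 := rfl
/-- Middle → middle': `1` on the diagonal. -/
@[simp] theorem laySubst_mid'_mid (j i : Fin a) :
    laySubst ((j, Sum.inr true), (i, Sum.inr false)) = if i = j then 1 else 0 := rfl
/-- Middle' → layer: `1` on the diagonal. -/
@[simp] theorem laySubst_inl_mid' (j i : Fin a) (b' : Bool) :
    laySubst ((j, Sum.inl b'), (i, Sum.inr true)) = if i = j then 1 else 0 := rfl
/-- No edge layer → middle'. -/
@[simp] theorem laySubst_mid'_inl (j i : Fin a) (b : Bool) :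
    laySubst ((j, Sum.inr true), (i, Sum.inl b)) = 0 := rfl
/-- No edge middle → layer. -/
@[simp] theorem laySubst_inl_mid (j i : Fin a) (b' : Bool) :
    laySubst ((j, Sum.inl b'), (i, Sum.inr false)) = 0 := rfl
/-- No edge middle → middle. -/
@[simp] theorem laySubst_mid_mid (j i : Fin a) :
    laySubst ((j, Sum.inr false), (i, Sum.inr false)) = 0 := rfl
/-- No edge out of middle' into the middle vertices. -/
@[simp] theorem laySubst_inr_mid' (j i : Fin a) (c : Bool) :
    laySubst ((j, Sum.inr c), (i, Sum.inr true)) = 0 := by cases c <;> rfl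

/-- Every value of the substitution is affine (a variable, `1` or `0`). [folklore] -/
theorem totalDegree_laySubst_le (rc : (Fin a × (Bool ⊕ Bool)) × (Fin a × (Bool ⊕ Bool))) :
    (laySubst rc).totalDegree ≤ 1 := by
  obtain ⟨⟨j, b' | c'⟩, ⟨i, b | c⟩⟩ := rc
  · rw [laySubst_inl_inl]
    split_ifs
    · exact (totalDegree_X _).le
    · simp
  · cases c <;> simp [apply_ite totalDegree]
  · cases c' <;> simp [apply_ite totalDegree]
  · cases c <;> cases c' <;> simp [apply_ite totalDegree]

/-- Every value of the substitution is a variable or a constant (a Valiant projection). [folklore] -/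
theorem laySubst_isVarOrConst (rc : (Fin a × (Bool ⊕ Bool)) × (Fin a × (Bool ⊕ Bool))) :
    (∃ k, laySubst rc = X k) ∨ ∃ c, laySubst rc = C c := by
  obtain ⟨⟨j, b' | c'⟩, ⟨i, b | c⟩⟩ := rc
  · rw [laySubst_inl_inl]
    split_ifs
    · exact Or.inl ⟨(j, i), rfl⟩
    · exact Or.inr ⟨0, by simp⟩
  · cases c
    · exact Or.inr ⟨0, by simp⟩
    · rw [laySubst_inl_mid']
      split_ifs
      · exact Or.inr ⟨1, by simp⟩
      · exact Or.inr ⟨0, by simp⟩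
  · cases c'
    · rw [laySubst_mid_inl]
      split_ifs
      · exact Or.inr ⟨1, by simp⟩
      · exact Or.inr ⟨0, by simp⟩
    · exact Or.inr ⟨0, by simp⟩
  · cases c
    · cases c'
      · exact Or.inr ⟨0, by simp⟩
      · rw [laySubst_mid'_mid]
        split_ifs
        · exact Or.inr ⟨1, by simp⟩
        · exact Or.inr ⟨0, by simp⟩
    · exact Or.inr ⟨0, by simp⟩

/-! ## §2 The surviving covers `layPerm ρ s` -/

/-- The `4`-cycle `inl b → inr false → inr true → inl ¬b → inl b` of the gadget of one point
entered on layer `b`.  A proof gadget. [folklore] -/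
def layCycle (b : Bool) : Perm (Bool ⊕ Bool) :=
  swap (Sum.inl b) (Sum.inr false) * swap (Sum.inr false) (Sum.inr true) *
    swap (Sum.inr true) (Sum.inl (!b))

/-- `layCycle b (inl b) = inr false`. -/
@[simp] theorem layCycle_inl_self (b : Bool) :
    layCycle b (Sum.inl b) = Sum.inr false := by cases b <;> decide
/-- `layCycle b (inr false) = inr true`. -/
@[simp] theorem layCycle_mid (b : Bool) :
    layCycle b (Sum.inr false) = Sum.inr true := by cases b <;> decide
/-- `layCycle b (inr true) = inl ¬b`. -/
@[simp] theorem layCycle_mid' (b : Bool) :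
    layCycle b (Sum.inr true) = Sum.inl (!b) := by cases b <;> decide
/-- `layCycle b (inl ¬b) = inl b`. -/
@[simp] theorem layCycle_inl_not (b : Bool) :
    layCycle b (Sum.inl (!b)) = Sum.inl b := by cases b <;> decide
/-- A `4`-cycle is odd. -/
theorem sign_layCycle (b : Bool) : Perm.sign (layCycle b) = -1 := by cases b <;> decide

/-- The entry vertices `(i, inl (s i))` as a subtype equivalent to `Fin a`.  A proof gadget.
[folklore] -/
def layEntry (s : Fin a → Bool) :
    Fin a ≃ {v : Fin a × (Bool ⊕ Bool) // v.2 = Sum.inl (s v.1)} where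
  toFun i := ⟨(i, Sum.inl (s i)), rfl⟩
  invFun v := v.1.1
  left_inv i := rfl
  right_inv v := by
    obtain ⟨⟨i, t⟩, ht⟩ := v
    simp only at ht
    subst ht
    rfl

/-- THE SURVIVING COVERS: `layPerm ρ s` walks `(i, inl (s i)) → m_i → m'_i → (i, inl ¬(s i))`
inside the gadget of `i` and then jumps to the entry vertex of `ρ i` (the composite of `ρ`
transported to the entry vertices with the gadget `4`-cycles).  A proof gadget. [folklore] -/
def layPerm (ρ : Perm (Fin a)) (s : Fin a → Bool) : Perm (Fin a × (Bool ⊕ Bool)) :=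
  ρ.extendDomain (layEntry s) * Equiv.prodCongrRight fun i => layCycle (s i)

/-- Entry vertex ↦ middle vertex. -/
theorem layPerm_entry (ρ : Perm (Fin a)) (s : Fin a → Bool) (i : Fin a) :
    layPerm ρ s (i, Sum.inl (s i)) = (i, Sum.inr false) := by
  rw [layPerm, Perm.mul_apply, Equiv.prodCongrRight_apply, layCycle_inl_self,
    Perm.extendDomain_apply_not_subtype]
  simp

/-- Middle ↦ middle'. -/
theorem layPerm_mid (ρ : Perm (Fin a)) (s : Fin a → Bool) (i : Fin a) :
    layPerm ρ s (i, Sum.inr false) = (i, Sum.inr true) := by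
  rw [layPerm, Perm.mul_apply, Equiv.prodCongrRight_apply, layCycle_mid,
    Perm.extendDomain_apply_not_subtype]
  simp

/-- Middle' ↦ exit vertex (the other layer). -/
theorem layPerm_mid' (ρ : Perm (Fin a)) (s : Fin a → Bool) (i : Fin a) :
    layPerm ρ s (i, Sum.inr true) = (i, Sum.inl (!s i)) := by
  rw [layPerm, Perm.mul_apply, Equiv.prodCongrRight_apply, layCycle_mid',
    Perm.extendDomain_apply_not_subtype]
  simp

/-- Exit vertex ↦ entry vertex of `ρ i` (in general position). -/
theorem layPerm_exit' (ρ : Perm (Fin a)) (s : Fin a → Bool) (i : Fin a) :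
    layPerm ρ s (i, Sum.inl (!s i)) = (ρ i, Sum.inl (s (ρ i))) := by
  rw [layPerm, Perm.mul_apply, Equiv.prodCongrRight_apply, layCycle_inl_not]
  exact Perm.extendDomain_apply_image ρ (layEntry s) i

/-- Exit vertex ↦ `(ρ i, same layer)` when `s` is a `2`-colouring of `ρ`. -/
theorem layPerm_exit (ρ : Perm (Fin a)) (s : Fin a → Bool) (hs : ∀ i, s (ρ i) = !s i)
    (i : Fin a) : layPerm ρ s (i, Sum.inl (!s i)) = (ρ i, Sum.inl (!s i)) := by
  rw [layPerm_exit', hs]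

/-- `sgn (layPerm ρ s) = sgn ρ · (-1)^a` (the transported `ρ` times `a` four-cycles; stated on
the integer values to stay clear of the two power instances on `ℤˣ`). [folklore] -/
theorem sign_layPerm (ρ : Perm (Fin a)) (s : Fin a → Bool) :
    ((Perm.sign (layPerm ρ s) : ℤˣ) : ℤ) = (Perm.sign ρ : ℤ) * (-1) ^ a := by
  rw [layPerm, Perm.sign_mul, Perm.sign_extendDomain, Perm.sign_prodCongrRight, Units.val_mul,
    Units.coe_prod]
  simp [sign_layCycle, Finset.prod_const]

/-- The `2`-colouring of the cover `layPerm ρ s`: entry vertices and `m'` get `false`, exit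
vertices and `m` get `true`.  A proof gadget. [folklore] -/
def layColour (s : Fin a → Bool) : Fin a × (Bool ⊕ Bool) → Bool
  | (i, Sum.inl b) => xor b (s i)
  | (_, Sum.inr c) => !c

/-- `layColour s` is a `2`-colouring of `layPerm ρ s` when `s` is a `2`-colouring of `ρ`. -/
theorem layColour_layPerm (ρ : Perm (Fin a)) (s : Fin a → Bool) (hs : ∀ i, s (ρ i) = !s i)
    (v : Fin a × (Bool ⊕ Bool)) : layColour s (layPerm ρ s v) = !layColour s v := by
  obtain ⟨i, b | c⟩ := v
  · rcases Bool.eq_or_eq_not b (s i) with rfl | rfl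
    · rw [layPerm_entry]; simp [layColour]
    · rw [layPerm_exit ρ s hs]; simp [layColour, hs]
  · cases c
    · rw [layPerm_mid]; simp [layColour]
    · rw [layPerm_mid']; simp [layColour]

/-- Hence the covers `layPerm ρ s` are all-even and `dEvenClass (layPerm ρ s) = (-1)^a sgn ρ`. -/
theorem dEvenClass_layPerm (ρ : Perm (Fin a)) (s : Fin a → Bool) (hs : ∀ i, s (ρ i) = !s i) :
    dEvenClass (layPerm ρ s) = (-1) ^ a * ((Perm.sign ρ : ℤ) : ℂ) := by
  rw [dEvenClass_eq_sign_of_antiInvariant (layColour s) (layColour_layPerm ρ s hs), sign_layPerm]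
  push_cast
  ring

/-- The substituted monomial of a surviving cover is `Y^ρ`. [folklore] -/
theorem prod_laySubst_layPerm (ρ : Perm (Fin a)) (s : Fin a → Bool) (hs : ∀ i, s (ρ i) = !s i) :
    ∏ v, laySubst (layPerm ρ s v, v) = ∏ i, (X (ρ i, i) : MvPolynomial (Fin a × Fin a) ℂ) := by
  rw [Fintype.prod_prod_type]
  refine Finset.prod_congr rfl fun i _ => ?_
  rw [Fintype.prod_sum_type, Fintype.prod_bool, Fintype.prod_bool, layPerm_mid, layPerm_mid',
    laySubst_mid'_mid, laySubst_inl_mid', if_pos rfl]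
  have h1 := layPerm_entry ρ s i
  have h2 := layPerm_exit ρ s hs i
  cases h : s i <;> simp only [h, Bool.not_false, Bool.not_true] at h1 h2 <;> rw [h1, h2] <;> simp

/-- `(ρ, s) ↦ layPerm ρ s` is injective (the entry layer of `i` is read off at `(i, inl true)`,
`ρ i` at the exit vertex). [folklore] -/
theorem layPerm_injective_pair {ρ ρ' : Perm (Fin a)} {s s' : Fin a → Bool}
    (h : layPerm ρ s = layPerm ρ' s') : ρ = ρ' ∧ s = s' := by
  have hs : s = s' := by
    funext i
    by_contra hne
    have h1 := layPerm_entry ρ s i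
    have h2 := layPerm_exit' ρ' s' i
    have hb : s i = !s' i := by
      cases h3 : s i <;> cases h4 : s' i <;> simp_all
    rw [h, hb, h2] at h1
    exact absurd (congrArg Prod.snd h1) (by simp)
  subst hs
  refine ⟨Equiv.ext fun i => ?_, rfl⟩
  have h1 := layPerm_exit' ρ s i
  rw [h, layPerm_exit'] at h1
  exact (congrArg Prod.fst h1).symm

end LayerGadget

end Summit.ValiantsHypothesis.ValiantsHypothesis.Theorems.TwistedDetRankSliceVBPFermionic

end
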